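import Summits.CriticalPhenomena.PercolationContinuityZ3.Theorems.PercNearOneGluingNoHeavyPcintNawFreeZ4F10Check1
import Summits.CriticalPhenomena.PercolationContinuityZ3.Theorems.PercNearOneGluingNoHeavyPcintNawFreeZ4F10Check2
import Summits.CriticalPhenomena.PercolationContinuityZ3.Theorems.PercNearOneGluingNoHeavyPcintNawFreeZ4F10Check3
import HarnessLib

/-!
# PCINT lane, kernel reduced-state B2d (`nawfree`) certificate `Z4F10` (d = 4, memory τ = 10, delay kt = 4, 729 state classes): the theorem

Cell `prim-pcint`, seat `prim-pcint-1` (gen 6); memo `run/shared/lean/prim/pcint/REDUCTIONS.md` §B2d (delayed chain payments with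
free-neighbour shares).  Does NOT build on p205010.  Data for `NawK.le_siteCriticalProb_of_checkRowsF` (`…PcintNawFreeMemKernelCert`):
`p = 17020/100000`, weight table `Q_k/100000`, `Q = [82980, 82980, 91094, 93971, 95443, 96338, 96939, 97370, 97695]` (`Q_k^k·100000 ≥ (100000-17020)·100000^k`, nondecreasing), `λ = 99999/100000`; Collatz–Wielandt
weights (scale 10⁹) from a power iteration, exact off-line max row ratio 0.9994740638 < λ.  Generated by work/gen6/gen_free.py
(pcint-1 gen 6 folder); the kernel re-checks every row.
-/

namespace Summit.CriticalPhenomena.PercolationContinuityZ3.Theorems.Pcint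

open Literature.Probability.Percolation Literature.Probability.LatticeModels

/-- Every row of the certificate passes. [folklore] -/
theorem NawFreeZ4F10.all_rows : WinK.allRange (NawK.checkRowF 10 4 4 729 17020 100000 99999 100000 NawFreeZ4F10.QL NawFreeZ4F10.syms NawFreeZ4F10.tree) 0 729 = true := (WinK.allRange_split (WinK.allRange_split NawFreeZ4F10.file_1 NawFreeZ4F10.file_2) NawFreeZ4F10.file_3)


/-- **`p_c^site(ℤ^4) ≥ 0.1702`** (kernel-checked reduced-state B2d certificate: delayed chain payments with free-neighbour shares on the
memory-`10` dangerous-set automaton, delay kt = 4, 729 state classes, `decide +kernel` only). [folklore] -/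
theorem siteCriticalProb_Z4_ge_01702_free : (0.1702 : ℝ) ≤ siteCriticalProb (zdGraph 4) 0 := by
  have h := NawK.le_siteCriticalProb_of_checkRowsF (d := 4) (τ := 10) (kt := 4) (N := 729) (pn := 17020) (D := 100000)
    (lamN := 99999) (lamD := 100000) (QL := NawFreeZ4F10.QL) (syms := NawFreeZ4F10.syms) (t := NawFreeZ4F10.tree)
    (by norm_num) (by norm_num) (by norm_num)
    (fun c => NawK.symOfTab 4 (NawFreeZ4F10.syms.getD c [])) (NawK.syms_spec_of_valid NawFreeZ4F10.syms_valid)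
    (fun i hi => WinK.of_allRange NawFreeZ4F10.all_rows (Nat.zero_le i) hi)
    (by norm_num) (by decide +kernel) (by norm_num) (by norm_num) (by decide +kernel) (by norm_num)
  have e : ((17020 : ℕ) : ℝ) / ((100000 : ℕ) : ℝ) = (0.1702 : ℝ) := by norm_num
  rw [e] at h
  exact h

end Summit.CriticalPhenomena.PercolationContinuityZ3.Theorems.Pcint
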